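import Summits.CriticalPhenomena.CardyFormulaZ2.Theorems.CardyComplexConeParafermionToSLESixFamiliesDiamondTouchLowerGlue
import Summits.CriticalPhenomena.CardyFormulaZ2.Theorems.CardyComplexConeParafermionToSLESixFamiliesDiamondTouchLowerCount
import Summits.CriticalPhenomena.CardyFormulaZ2.Theorems.CardyComplexConeParafermionToSLESixFamiliesDiamondTouchLowerWiredSegment
import HarnessLib

/-!
# The per-mesh bookkeeping of the free-side touch bound: scale, depths, connector window, room for the arm, rate and
# count (line `potential-darboux-picard-diamond`, S3 (c) `freeTouchLower_of_diagArmLower`, part 9)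

Crux `ParafermionToSLESixFamilies` (stmt-CriticalPhenomena-11389), line `potential-darboux-picard-diamond`, conditional
helper `freeTouchLower_of_diagArmLower` of S3. The assembly of the touch bound (`…DiamondFreeTouchLower.lean`) reads an
admissible datum on a marked diamond at a small mesh `δ` in the four side charts (`…TouchLowerBox`) and needs, with
`h = δ/√2`, `κ` a fixed fraction of the geometry and `m = ⌊κ/h⌋` the scale of the arm:

* `scale_facts`, `depth_facts` — `m h ≤ κ < (m+1) h`, `m` dominates the given thresholds, and the depths
  `n j + n (j+2) − 4` of the box lie between `m` (indeed `3m`) and `K m` for the fixed aspect ratio `K`;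
* `seg_frame` — the frame coordinates of a boundary segment from its side data (`segData_of_isBdrySegment`);
* `connector_window` — a tangential window of width `m` in the bulk of the wired segment, whose boundary layer is made of
  `A`-sites (`eventually_arcs_near_wiredSegment`), inside the tangential range of the interior;
* `site_room` — a touch-row site of the middle half of the free side has room `2m` on both sides for its arm;
* `real_armEv_ge`, `rate_bound` — the arm event of a touch-row site has probability `≥ ½ c_A (2m+1)^{-1/3} ≥ C δ^{1/3}`
  (`real_armEv_eq`, `real_arm_std_ge`, the hypothesis `DiagHalfPlaneOneArmLower` read at scale `2m + 1`);
* `count_facts` — the middle half carries `N = ⌊(L/2 − 6δ)/(2h)⌋ ≥ L/(4δ)` touch-row sites.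
-/

noncomputable section

namespace Summit.CriticalPhenomena.CardyFormulaZ2.Cruxes.ParafermionToSLESixFamilies.PotentialDarbouxPicardDiamond

open scoped Topology BigOperators
open Filter Set Metric Complex MeasureTheory
open Literature.Probability Literature.Probability.LatticeModels Literature.Probability.Percolation
open Literature.Probability.LatticeModels.DiscreteDobrushin
open Literature.Probability.RandomPlanarGeometry
open Literature.Probability.Percolation.TrackExchange (col hgtOf)
open Summit.CriticalPhenomena.CardyFormulaZ2.Cruxes.ParafermionToSLESixFamilies.IicTraceFluxPairing

/-- The depth of `v` below the touch row of side `k` (last inside layer `n k`). -/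
local notation3 "dp[" n ", " k ", " v "]" => (n : Fin 4 → ℤ) k - 2 - layerFn (k + 2) v
/-- The rotation of side `k`. -/
local notation3 "SR[" k "]" => (![zdSignedPermIso (Equiv.swap 0 1) ![-1, 1], zdSignedPermIso 1 (fun _ => -1),
    zdSignedPermIso (Equiv.swap 0 1) ![1, -1], zdSignedPermIso 1 (fun _ => 1)] : Fin 4 → (zdGraph 2 ≃g zdGraph 2)) k
/-- The lattice automorphism based at the site `x` of side `k`. -/
local notation3 "SI[" k ", " x "]" => (zdShiftIso ((SR[k]).symm x)).trans SR[k]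
/-- The angle of the drawing of side `k`. -/
local notation3 "SA[" k "]" => (![-(Real.pi / 2), Real.pi, Real.pi / 2, 0] : Fin 4 → ℝ) k
/-- The isoradial drawing of side `k`. -/
local notation3 "SE[" n ", " k "]" => (gmEmbedding (fun _ => SA[k]) (fun _ => SA[k] + Real.pi / 2)).translate
    ((((n : Fin 4 → ℤ) k - 2 : ℤ) : ℂ) * I)
/-- The interior of the lattice box: depth `≥ 0` below all four touch rows. -/
local notation3 "boxI[" n "]" => {v : Site 2 | ∀ j : Fin 4, 0 ≤ dp[n, j, v]}
/-- The strip of depth `≤ w` along side `j`, inside the interior. -/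
local notation3 "strip[" n ", " w ", " j "]" => {v : Site 2 | (∀ i : Fin 4, 0 ≤ dp[n, i, v]) ∧ dp[n, j, v] ≤ w}
/-- The touch row of side `j` (depth `0`). -/
local notation3 "face[" n ", " j "]" => {v : Site 2 | dp[n, j, v] = 0}
/-- The crossing event of the strip of side `j` (the long way, from the touch row of side `j + 3` to that of `j + 1`). -/
local notation3 "crossEv[" n ", " w ", " j "]" => openCrossing strip[n, w, j] face[n, j + 3] face[n, j + 1]
/-- The ring event: all four strips are crossed the long way. -/
local notation3 "ringEv[" n ", " w "]" => ⋂ j : Fin 4, crossEv[n, w, j]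
/-- The connector of side `k` at tangential position `lo`: the box `[lo, lo + w] × [−1, w]` of the frame of side `k`. -/
local notation3 "connQ[" n ", " w ", " k ", " lo "]" => {v : Site 2 | lo ≤ layerFn (k + 3) v ∧ layerFn (k + 3) v ≤ lo + w ∧
    -1 ≤ dp[n, k, v] ∧ dp[n, k, v] ≤ w}
/-- The connector event: the connector is crossed from the boundary layer `dp = −1` to the depth `w`. -/
local notation3 "connEv[" n ", " w ", " k ", " lo "]" => openCrossing connQ[n, w, k, lo] {v : Site 2 | dp[n, k, v] = -1}
    {v : Site 2 | dp[n, k, v] = w}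
/-- The arm event of the touch-row site `x` of side `k` to half-plane distance `N`. -/
local notation3 "armEv[" n ", " k ", " x ", " N "]" => openCrossing
    {v : Site 2 | 0 ≤ dp[n, k, v] ∧ max |layerFn (k + 3) v - layerFn (k + 3) x| (dp[n, k, v] - dp[n, k, x]) ≤ N} {x}
    {v : Site 2 | max |layerFn (k + 3) v - layerFn (k + 3) x| (dp[n, k, v] - dp[n, k, x]) = N}
/-- The U event at scale `m` around the site `x` of side `k` (two pillars crossed across, one bar crossed along). -/
local notation3 "uEv[" n ", " k ", " x ", " m "]" =>
    openCrossing {v : Site 2 | layerFn (k + 3) x + m ≤ layerFn (k + 3) v ∧ layerFn (k + 3) v ≤ layerFn (k + 3) x + 2 * m ∧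
        0 ≤ dp[n, k, v] ∧ dp[n, k, v] ≤ dp[n, k, x] + 2 * m} {v : Site 2 | dp[n, k, v] = 0}
        {v : Site 2 | dp[n, k, v] = dp[n, k, x] + 2 * m} ∩
      openCrossing {v : Site 2 | layerFn (k + 3) x - 2 * m ≤ layerFn (k + 3) v ∧ layerFn (k + 3) v ≤ layerFn (k + 3) x + 2 * m ∧
        dp[n, k, x] + m ≤ dp[n, k, v] ∧ dp[n, k, v] ≤ dp[n, k, x] + 2 * m} {v : Site 2 | layerFn (k + 3) v = layerFn (k + 3) x - 2 * m}
        {v : Site 2 | layerFn (k + 3) v = layerFn (k + 3) x + 2 * m} ∩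
      openCrossing {v : Site 2 | layerFn (k + 3) x - 2 * m ≤ layerFn (k + 3) v ∧ layerFn (k + 3) v ≤ layerFn (k + 3) x - m ∧
        0 ≤ dp[n, k, v] ∧ dp[n, k, v] ≤ dp[n, k, x] + 2 * m} {v : Site 2 | dp[n, k, v] = 0}
        {v : Site 2 | dp[n, k, v] = dp[n, k, x] + 2 * m}
/-- The vertical connector event at `x`: the box `[tng x − m, tng x + m] × [0, 3m]` of side `k` is crossed across. -/
local notation3 "vEv[" n ", " k ", " x ", " m "]" => openCrossing
    {v : Site 2 | layerFn (k + 3) x - m ≤ layerFn (k + 3) v ∧ layerFn (k + 3) v ≤ layerFn (k + 3) x + m ∧ 0 ≤ dp[n, k, v] ∧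
      dp[n, k, v] ≤ 3 * m} {v : Site 2 | dp[n, k, v] = 0} {v : Site 2 | dp[n, k, v] = 3 * m}

/-- The lattice site with chart coordinates `(A, B)` of orientation `j` (meaningful for `A ≡ B (mod 2)`). -/
local notation3 "site[" j ", " A ", " B "]" => (((A : ℤ) - B) / 2) • cornerUnit (j + 1) + ((A + B) / 2) • cornerUnit (j + 2)

/-! ## Real-arithmetic lemmas -/

/-- `1.414 < √2 < 1.415`. -/
theorem sqrt_two_bounds : 1.414 < Real.sqrt 2 ∧ Real.sqrt 2 < 1.415 := by
  constructor
  · rw [Real.lt_sqrt (by norm_num)]; norm_num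
  · rw [Real.sqrt_lt' (by norm_num)]; norm_num

/-- An integer ceiling in a window of width `h`: `a ≤ h ⌈(a − Y)/h⌉ + Y < a + h`. -/
theorem ceil_window {h a Y : ℝ} (hh : 0 < h) : a ≤ h * ⌈(a - Y) / h⌉ + Y ∧ h * ⌈(a - Y) / h⌉ + Y < a + h := by
  have h1 := Int.le_ceil ((a - Y) / h)
  have h2 := Int.ceil_lt_add_one ((a - Y) / h)
  rw [div_le_iff₀ hh] at h1
  have h3 : (⌈(a - Y) / h⌉ : ℝ) * h < ((a - Y) / h + 1) * h := mul_lt_mul_of_pos_right h2 hh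
  rw [add_mul, div_mul_cancel₀ _ hh.ne', one_mul] at h3
  constructor <;> nlinarith

/-- An even step above a threshold: for `B = A + 2⌈(r − A)/2⌉`, `r ≤ B ≤ r + 2`. -/
theorem even_step_window (A : ℤ) (r : ℝ) : r ≤ (A + 2 * ⌈(r - A) / 2⌉ : ℤ) ∧ ((A + 2 * ⌈(r - A) / 2⌉ : ℤ) : ℝ) ≤ r + 2 := by
  have h1 := Int.le_ceil ((r - A) / 2)
  have h2 := (Int.ceil_lt_add_one ((r - A) / 2)).le
  rw [div_le_iff₀ two_pos] at h1
  have h3 : (⌈(r - A) / 2⌉ : ℝ) * 2 ≤ ((r - A) / 2 + 1) * 2 := mul_le_mul_of_nonneg_right h2 zero_le_two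
  rw [add_mul, div_mul_cancel₀ _ two_ne_zero, one_mul] at h3
  push_cast
  constructor <;> linarith

/-- `(u/δ)^{-1/3} = u^{-1/3} · δ^{1/3}` for `u, δ > 0`. -/
theorem rpow_neg_third_div {u δ : ℝ} (hu : 0 < u) (hδ : 0 < δ) :
    (u / δ) ^ (-((1:ℝ) / 3)) = u ^ (-((1:ℝ) / 3)) * δ ^ ((1:ℝ) / 3) := by
  rw [Real.div_rpow hu.le hδ.le, Real.rpow_neg hδ.le, div_inv_eq_mul]

/-- `δ^{2/3} · (A/δ) · (C · δ^{1/3}) = A · C` for `δ > 0`. -/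
theorem rpow_two_thirds_mul {δ : ℝ} (hδ : 0 < δ) (A C : ℝ) : δ ^ ((2:ℝ) / 3) * (A / δ) * (C * δ ^ ((1:ℝ) / 3)) = A * C := by
  have h : δ ^ ((2:ℝ) / 3) * δ ^ ((1:ℝ) / 3) = δ := by
    rw [← Real.rpow_add hδ]; norm_num
  field_simp
  linear_combination A * C * h

/-- The half-widths are at most `α + β`. -/
theorem sideHalfWidth_le (α β : ℝ) (hα : 0 < α) (hβ : 0 < β) (k : Fin 4) :
    sideHalfWidth α β k ≤ α + β ∧ sideHalfLength α β k ≤ α + β := by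
  fin_cases k <;> simp [sideHalfWidth, sideHalfLength] <;> constructor <;> linarith

/-! ## The scale and the depths -/

/-- **The scale `m = ⌊κ/h⌋`.** For `0 < h ≤ δ` and `(M + 2) δ ≤ κ`: `m h ≤ κ`, `κ − h < m h`, `M + 1 ≤ m`, `h ≤ κ`. -/
theorem scale_facts {κ h δ M : ℝ} (hh : 0 < h) (hhδ : h ≤ δ) (hM : 0 ≤ M) (hκ : (M + 2) * δ ≤ κ) :
    (⌊κ / h⌋ : ℝ) * h ≤ κ ∧ κ - h < ⌊κ / h⌋ * h ∧ M + 1 ≤ ⌊κ / h⌋ ∧ h ≤ κ := by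
  have hm1 : (⌊κ / h⌋ : ℝ) ≤ κ / h := Int.floor_le _
  have hm2 : κ / h < ⌊κ / h⌋ + 1 := Int.lt_floor_add_one _
  rw [le_div_iff₀ hh] at hm1
  rw [div_lt_iff₀ hh] at hm2
  have hmh' : κ - h < ⌊κ / h⌋ * h := by linarith
  refine ⟨hm1, hmh', ?_, by nlinarith⟩
  have h1 : (M + 1) * h ≤ κ - h := by nlinarith
  exact le_of_mul_le_mul_right (h1.trans hmh'.le) hh

/-- **The depths dominate the scale and are dominated by `K` scales.** From the width bounds of the four charts
(`depth_bounds`), `m h ≤ κ ≤ min α β / 4`, `κ − h < m h`, `h ≤ min α β / 5`, `4(α+β) + κ ≤ K κ` and `K h ≤ 2(α+β) + κ`: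
`m ≤ n j + n (j+2) − 4 ≤ K m` for all `j`, `3m ≤ n j + n (j+2) − 4`, and `6 ≤ n 1 + n 3`. -/
theorem depth_facts {α β h κ : ℝ} (hh : 0 < h) {n : Fin 4 → ℤ}
    (hdepth : ∀ j, 2 * sideHalfWidth α β j - 2 * h ≤ h * (n j + n (j + 2)) ∧ h * (n j + n (j + 2)) < 2 * sideHalfWidth α β j)
    {m : ℤ} (hmh : (m : ℝ) * h ≤ κ) (hmh' : κ - h < m * h) (hκm : κ ≤ min α β / 4) (hhm : h ≤ min α β / 5) {K : ℕ}
    (hKκ : 4 * (α + β) + κ ≤ K * κ) (hKh : (K : ℝ) * h ≤ 2 * (α + β) + κ) :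
    (∀ j, m ≤ n j + n (j + 2) - 4) ∧ (∀ j, 3 * m ≤ n j + n (j + 2) - 4) ∧ 6 ≤ n 1 + n 3 ∧ (∀ j, n j + n (j + 2) - 4 ≤ K * m) := by
  have hmin := fun j => min_le_sideHalfWidth α β j
  have hminα : min α β ≤ α := min_le_left α β
  have hminβ : min α β ≤ β := min_le_right α β
  have cast : ∀ j, ((n j + n (j + 2) - 4 : ℤ) : ℝ) * h = h * (n j + n (j + 2)) - 4 * h := fun j => by push_cast; ring
  refine ⟨fun j => ?_, fun j => ?_, ?_, fun j => ?_⟩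
  · have h1 := (hdepth j).1
    have h2 := hmin j
    have key : (m : ℝ) * h ≤ ((n j + n (j + 2) - 4 : ℤ) : ℝ) * h := by rw [cast]; linarith
    exact_mod_cast le_of_mul_le_mul_right key hh
  · have h1 := (hdepth j).1
    have h2 := hmin j
    have key : ((3 * m : ℤ) : ℝ) * h ≤ ((n j + n (j + 2) - 4 : ℤ) : ℝ) * h := by rw [cast]; push_cast; linarith
    exact_mod_cast le_of_mul_le_mul_right key hh
  · have h1 := (hdepth 1).1
    have e : sideHalfWidth α β 1 = α := by simp [sideHalfWidth]
    rw [e, show (1 : Fin 4) + 2 = 3 by decide] at h1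
    have key : ((6 : ℤ) : ℝ) * h ≤ ((n 1 + n 3 : ℤ) : ℝ) * h := by push_cast; linarith
    exact_mod_cast le_of_mul_le_mul_right key hh
  · have h1 := (hdepth j).2
    have h2 : sideHalfWidth α β j ≤ α + β := by fin_cases j <;> simp [sideHalfWidth] <;> linarith
    have hK0 : (0 : ℝ) ≤ K := Nat.cast_nonneg K
    have h3 : (K : ℝ) * (κ - h) ≤ K * (m * h) := mul_le_mul_of_nonneg_left hmh'.le hK0
    have key : ((n j + n (j + 2) - 4 : ℤ) : ℝ) * h ≤ ((K * m : ℤ) : ℝ) * h := by rw [cast]; push_cast; nlinarith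
    exact_mod_cast le_of_mul_le_mul_right key hh

/-! ## The connector window of the wired segment -/

/-- **The frame data of a boundary segment of the diamond**: abscissa `sideHalfWidth`, ordinates `−sideHalfLength + s`,
`−sideHalfLength + t`, both within `[−sideHalfLength, sideHalfLength]`. -/
theorem seg_frame (c : ℂ) {α β : ℝ} {k : Fin 4} {s t : ℝ} (hs : 0 ≤ s) (ht : t ≤ dLen α β k) {p q : ℂ}
    (hP : dRot c p = dParam α β k s) (hQ : dRot c q = dParam α β k t) :
    ((p - c) * (exp (-(Real.pi / 4 : ℝ) * I) * sideFrame k)).re = sideHalfWidth α β k ∧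
    ((q - c) * (exp (-(Real.pi / 4 : ℝ) * I) * sideFrame k)).re = sideHalfWidth α β k ∧
    ((p - c) * (exp (-(Real.pi / 4 : ℝ) * I) * sideFrame k)).im = -sideHalfLength α β k + s ∧
    ((q - c) * (exp (-(Real.pi / 4 : ℝ) * I) * sideFrame k)).im = -sideHalfLength α β k + t ∧
    -sideHalfLength α β k ≤ -sideHalfLength α β k + s ∧ -sideHalfLength α β k + t ≤ sideHalfLength α β k := by
  have hpe : (p - c) * (exp (-(Real.pi / 4 : ℝ) * I) * sideFrame k) = dParam α β k s * sideFrame k := by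
    rw [← mul_assoc]; exact congrArg (· * _) hP
  have hqe : (q - c) * (exp (-(Real.pi / 4 : ℝ) * I) * sideFrame k) = dParam α β k t * sideFrame k := by
    rw [← mul_assoc]; exact congrArg (· * _) hQ
  have hL := two_mul_sideHalfLength α β k
  refine ⟨by rw [hpe, re_dParam_mul_sideFrame], by rw [hqe, re_dParam_mul_sideFrame], by rw [hpe, im_dParam_mul_sideFrame],
    by rw [hqe, im_dParam_mul_sideFrame], by linarith, by linarith⟩

/-- **The connector window.** In the chart of the wired side `k'` (segment data `s₁ < t₁`, discrete boundary of the
`(t₁−s₁)/8`-bulk made of `A`-sites), for a scale `m` with `m h ≤ κ ≤ (t₁ − s₁)/4` and a mesh `δ ≤ (t₁ − s₁)/40`: there is a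
tangential position `lo` with `2 − n (k'+3) ≤ lo`, `lo + m ≤ n (k'+1) − 2`, and every site of the boundary layer
`n k' − 2 − layerFn (k'+2) = −1` with tangential coordinate in `[lo, lo + m]` is off `B` and on `A`. -/
theorem connector_window {c : ℂ} {α β δ : ℝ} (hδ : 0 < δ) {X₀ Y₀ : Fin 4 → ℝ} {n : Fin 4 → ℤ}
    (hch : ∀ k : Fin 4,
      ‖exp (-(Real.pi / 4 : ℝ) * I) * sideFrame k‖ = 1 ∧
      {z : ℂ | |((z - c) * exp (-(Real.pi / 4 : ℝ) * I)).re| < α ∧ |((z - c) * exp (-(Real.pi / 4 : ℝ) * I)).im| < β} =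
        {z : ℂ | |((z - c) * (exp (-(Real.pi / 4 : ℝ) * I) * sideFrame k)).re| < sideHalfWidth α β k ∧
          |((z - c) * (exp (-(Real.pi / 4 : ℝ) * I) * sideFrame k)).im| < sideHalfLength α β k} ∧
      (∀ x : Site 2, ((meshPoint δ x - c) * (exp (-(Real.pi / 4 : ℝ) * I) * sideFrame k)).re =
        Real.sqrt 2 / 2 * δ * layerFn (k + 2) x + X₀ k) ∧
      (∀ x : Site 2, ((meshPoint δ x - c) * (exp (-(Real.pi / 4 : ℝ) * I) * sideFrame k)).im =
        Real.sqrt 2 / 2 * δ * layerFn (k + 2 + 1) x + Y₀ k) ∧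
      Real.sqrt 2 / 2 * δ * n k + X₀ k < sideHalfWidth α β k ∧ sideHalfWidth α β k ≤ Real.sqrt 2 / 2 * δ * (n k + 1) + X₀ k)
    {E : DiscreteDobrushin} {k' : Fin 4} {s₁ t₁ : ℝ} (hs₁ : 0 ≤ s₁) (hst₁ : s₁ < t₁) (ht₁ : t₁ ≤ dLen α β k') {p₁ q₁ : ℂ}
    (hP₁ : dRot c p₁ = dParam α β k' s₁) (hQ₁ : dRot c q₁ = dParam α β k' t₁)
    (harcW : ∀ x : Site 2, infDist (meshPoint δ x) (segment ℝ p₁ q₁) ≤ 6 * δ → (t₁ - s₁) / 8 ≤ dist (meshPoint δ x) p₁ →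
      (t₁ - s₁) / 8 ≤ dist (meshPoint δ x) q₁ → x ∉ E.zdArcB ∧ (x ∈ E.zdBoundary → x ∈ E.zdArcA))
    {m : ℤ} {κ : ℝ} (hm0 : 0 ≤ m) (hmh : (m : ℝ) * (Real.sqrt 2 / 2 * δ) ≤ κ) (hκL₁ : κ ≤ (t₁ - s₁) / 4)
    (hδL₁ : δ ≤ (t₁ - s₁) / 40) :
    ∃ lo : ℤ, 2 - n (k' + 3) ≤ lo ∧ lo + m ≤ n (k' + 1) - 2 ∧
      ∀ v : Site 2, n k' - 2 - layerFn (k' + 2) v = -1 → lo ≤ layerFn (k' + 3) v → layerFn (k' + 3) v ≤ lo + m →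
        v ∉ E.zdArcB ∧ (v ∈ E.zdBoundary → v ∈ E.zdArcA) := by
  obtain ⟨he', -, hX', hY', hn, hn'⟩ := hch k'
  obtain ⟨hpX, hqX, hpY, hqY, hYp, hYq⟩ := seg_frame c hs₁ ht₁ hP₁ hQ₁
  set h : ℝ := Real.sqrt 2 / 2 * δ with hhdef
  obtain ⟨hs2a, hs2b⟩ := sqrt_two_bounds
  have hh0 : 0 < h := by positivity
  have hhδ : h ≤ δ := by rw [hhdef]; nlinarith
  set Yp := -sideHalfLength α β k' + s₁ with hYpdef
  set lo : ℤ := ⌈(Yp + (t₁ - s₁) / 4 - Y₀ k') / h⌉ with hlodef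
  obtain ⟨hlo1, hlo2⟩ := ceil_window (a := Yp + (t₁ - s₁) / 4) (Y := Y₀ k') hh0
  have hmh0 : 0 ≤ (m : ℝ) * h := by positivity
  -- the ordinate of a site of tangential coordinate `B`
  have ord : ∀ {y : Site 2} {B : ℤ}, layerFn (k' + 3) y = B →
      ((meshPoint δ y - c) * (exp (-(Real.pi / 4 : ℝ) * I) * sideFrame k')).im = h * B + Y₀ k' := fun hB => by
    rw [hY', fin4_add_two_add_one, hB]
  refine ⟨lo, ?_, ?_, fun v hv h1 h2 => ?_⟩
  · -- room below: the site with tangential coordinate `lo − 2`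
    have hy : layerFn (k' + 3) site[k' + 2, lo - 2, lo - 2] = lo - 2 := by
      rw [← fin4_add_two_add_one]; exact (layerFn_siteOf (k' + 2) (A := lo - 2) (B := lo - 2) ⟨0, by ring⟩).2
    have key := neg_layerFn_add_three_le_of_lt_im hδ hch k' (y := site[k' + 2, lo - 2, lo - 2]) ?_
    · rw [hy] at key; omega
    · rw [ord hy]; push_cast; nlinarith
  · -- room above: the site with tangential coordinate `lo + m + 2`
    have hy : layerFn (k' + 3) site[k' + 2, lo + m + 2, lo + m + 2] = lo + m + 2 := by
      rw [← fin4_add_two_add_one]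
      exact (layerFn_siteOf (k' + 2) (A := lo + m + 2) (B := lo + m + 2) ⟨0, by ring⟩).2
    have key := layerFn_add_three_le_of_im_lt hδ hch k' (y := site[k' + 2, lo + m + 2, lo + m + 2]) ?_
    · rw [hy] at key; omega
    · rw [ord hy]; push_cast; nlinarith
  · -- the boundary layer of the window lies in the bulk of the wired segment
    have him := ord (y := v) rfl
    have h1' : (lo : ℝ) ≤ layerFn (k' + 3) v := by exact_mod_cast h1
    have h2' : (layerFn (k' + 3) v : ℝ) ≤ lo + m := by exact_mod_cast h2
    obtain ⟨hd, hp, hq⟩ := near_segment_of_chart he' hδ hpX hqX hpY hqY (by linarith) hX' hn hn'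
      (by positivity : (0:ℝ) ≤ (t₁ - s₁) / 8) v 1 (by push_cast; omega) (by omega) (by rw [him]; nlinarith)
      (by rw [him]; nlinarith)
    exact harcW v (by push_cast at hd; linarith) hp hq

/-! ## Room for the arm around a touch-row site of the window -/

/-- **A touch-row site of the middle half of the free side has room `2m` along the side for its arm** (both ends of the
arm's half-box stay inside the tangential range of the interior), for `m h ≤ κ ≤ L/16`, `δ ≤ L/60`. -/
theorem site_room {c : ℂ} {α β δ : ℝ} (hδ : 0 < δ) {X₀ Y₀ : Fin 4 → ℝ} {n : Fin 4 → ℤ}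
    (hch : ∀ k : Fin 4,
      ‖exp (-(Real.pi / 4 : ℝ) * I) * sideFrame k‖ = 1 ∧
      {z : ℂ | |((z - c) * exp (-(Real.pi / 4 : ℝ) * I)).re| < α ∧ |((z - c) * exp (-(Real.pi / 4 : ℝ) * I)).im| < β} =
        {z : ℂ | |((z - c) * (exp (-(Real.pi / 4 : ℝ) * I) * sideFrame k)).re| < sideHalfWidth α β k ∧
          |((z - c) * (exp (-(Real.pi / 4 : ℝ) * I) * sideFrame k)).im| < sideHalfLength α β k} ∧
      (∀ x : Site 2, ((meshPoint δ x - c) * (exp (-(Real.pi / 4 : ℝ) * I) * sideFrame k)).re =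
        Real.sqrt 2 / 2 * δ * layerFn (k + 2) x + X₀ k) ∧
      (∀ x : Site 2, ((meshPoint δ x - c) * (exp (-(Real.pi / 4 : ℝ) * I) * sideFrame k)).im =
        Real.sqrt 2 / 2 * δ * layerFn (k + 2 + 1) x + Y₀ k) ∧
      Real.sqrt 2 / 2 * δ * n k + X₀ k < sideHalfWidth α β k ∧ sideHalfWidth α β k ≤ Real.sqrt 2 / 2 * δ * (n k + 1) + X₀ k)
    {k : Fin 4} {Yp Yq : ℝ} (hYp : -sideHalfLength α β k ≤ Yp) (hYq : Yq ≤ sideHalfLength α β k) {B : ℤ}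
    (hpar : 2 ∣ n k - 2 - B) (hlow : Yp + (Yq - Yp) / 4 ≤ Real.sqrt 2 / 2 * δ * B + Y₀ k)
    (hup : Real.sqrt 2 / 2 * δ * B + Y₀ k ≤ Yq - (Yq - Yp) / 4) {m : ℤ} {κ : ℝ} (hm0 : 0 ≤ m)
    (hmh : (m : ℝ) * (Real.sqrt 2 / 2 * δ) ≤ κ) (hκL : κ ≤ (Yq - Yp) / 16) (hδL : δ ≤ (Yq - Yp) / 60) :
    n k - 2 - layerFn (k + 2) site[k + 2, n k - 2, B] = 0 ∧ layerFn (k + 3) site[k + 2, n k - 2, B] = B ∧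
      2 - n (k + 3) ≤ B - 2 * m ∧ B + 2 * m ≤ n (k + 1) - 2 := by
  obtain ⟨-, -, -, hY', -, -⟩ := hch k
  set h : ℝ := Real.sqrt 2 / 2 * δ with hhdef
  obtain ⟨hs2a, hs2b⟩ := sqrt_two_bounds
  have hh0 : 0 < h := by positivity
  have hhδ : h ≤ δ := by rw [hhdef]; nlinarith
  have hmh0 : 0 ≤ (m : ℝ) * h := by positivity
  have ord : ∀ {y : Site 2} {B : ℤ}, layerFn (k + 3) y = B →
      ((meshPoint δ y - c) * (exp (-(Real.pi / 4 : ℝ) * I) * sideFrame k)).im = h * B + Y₀ k := fun hB => by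
    rw [hY', fin4_add_two_add_one, hB]
  have hx1 := (layerFn_siteOf (k + 2) (A := n k - 2) (B := B) hpar).1
  have hx2 : layerFn (k + 3) site[k + 2, n k - 2, B] = B := by
    rw [← fin4_add_two_add_one]; exact (layerFn_siteOf (k + 2) (A := n k - 2) (B := B) hpar).2
  obtain ⟨t, ht⟩ := hpar
  refine ⟨by omega, hx2, ?_, ?_⟩
  · have hy : layerFn (k + 3) site[k + 2, n k - 2, B - 2 * m - 2] = B - 2 * m - 2 := by
      rw [← fin4_add_two_add_one]
      exact (layerFn_siteOf (k + 2) (A := n k - 2) (B := B - 2 * m - 2) ⟨t + m + 1, by omega⟩).2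
    have key := neg_layerFn_add_three_le_of_lt_im hδ hch k (y := site[k + 2, n k - 2, B - 2 * m - 2]) ?_
    · rw [hy] at key; omega
    · rw [ord hy]; push_cast; nlinarith
  · have hy : layerFn (k + 3) site[k + 2, n k - 2, B + 2 * m + 2] = B + 2 * m + 2 := by
      rw [← fin4_add_two_add_one]
      exact (layerFn_siteOf (k + 2) (A := n k - 2) (B := B + 2 * m + 2) ⟨t - m - 1, by omega⟩).2
    have key := layerFn_add_three_le_of_im_lt hδ hch k (y := site[k + 2, n k - 2, B + 2 * m + 2]) ?_
    · rw [hy] at key; omega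
    · rw [ord hy]; push_cast; nlinarith

/-! ## The arm probability and the count -/

/-- **The arm event of a touch-row site dominates half the crux line's one-arm bound at scale `2m + 1`.** -/
theorem real_armEv_ge {cA : ℝ} {N₀ : ℕ}
    (hN₀ : ∀ b : ℕ, N₀ ≤ b → cA * (b : ℝ) ^ (-((1:ℝ) / 3)) ≤ (bondPercolation (zdGraph 2) half).real
      {ω | ∃ y : Site 2, (y 0 + y 1 = -(b : ℤ) ∨ y 0 - y 1 = (b : ℤ) ∨ y 0 - y 1 = -(b : ℤ)) ∧
        ω ∈ openConnIn {v : Site 2 | v 0 + v 1 ≤ 1 ∧ -(b : ℤ) ≤ v 0 + v 1 ∧ -(b : ℤ) ≤ v 0 - v 1 ∧ v 0 - v 1 ≤ b} 0 y})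
    (n : Fin 4 → ℤ) (k : Fin 4) (x : Site 2) (hx : dp[n, k, x] = 0) {m : ℤ} (hm0 : 0 ≤ m) (hmN : (N₀ : ℤ) ≤ m) :
    1 / 2 * (cA * (((2 * m).toNat + 1 : ℕ) : ℝ) ^ (-((1:ℝ) / 3))) ≤ (bondPercolation (zdGraph 2) half).real armEv[n, k, x, 2 * m] := by
  rw [real_armEv_eq n k x hx]
  have e : (((2 * m).toNat : ℕ) : ℤ) = 2 * m := Int.toNat_of_nonneg (by omega)
  have key := real_arm_std_ge (2 * m).toNat
  simp only [e] at key
  have h2 := hN₀ ((2 * m).toNat + 1) (by omega)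
  linarith

/-- **The count of touch-row sites of the middle half**: `N = ⌊(L/2 − 6δ)/(2h)⌋ ≥ L/(4δ)` for `δ ≤ L/60`, and
`2hN ≤ L/2 − 6δ`. -/
theorem count_facts {L δ : ℝ} (hδ : 0 < δ) (hδL : δ ≤ L / 60) :
    L / (4 * δ) ≤ (⌊(L / 2 - 6 * δ) / (2 * (Real.sqrt 2 / 2 * δ))⌋₊ : ℝ) ∧
      2 * (Real.sqrt 2 / 2 * δ) * ⌊(L / 2 - 6 * δ) / (2 * (Real.sqrt 2 / 2 * δ))⌋₊ ≤ L / 2 - 6 * δ := by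
  set h : ℝ := Real.sqrt 2 / 2 * δ with hhdef
  obtain ⟨hs2a, hs2b⟩ := sqrt_two_bounds
  have hh0 : 0 < h := by positivity
  have h2h : 2 * h = Real.sqrt 2 * δ := by rw [hhdef]; ring
  have hx0 : 0 ≤ (L / 2 - 6 * δ) / (2 * h) := div_nonneg (by linarith) (by positivity)
  have hfl := Nat.floor_le hx0
  have hlt := Nat.lt_floor_add_one ((L / 2 - 6 * δ) / (2 * h))
  rw [h2h] at hfl hlt ⊢
  have hs0 : 0 < Real.sqrt 2 * δ := by positivity
  constructor
  · rw [div_lt_iff₀ hs0] at hlt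
    rw [div_le_iff₀ (by positivity)]
    nlinarith
  · rw [le_div_iff₀ hs0] at hfl
    linarith

/-- **The per-site rate**: `C₁ δ^{1/3} ≤ θ` where `θ = cg · ½ cA (2m+1)^{-1/3} · cr` and `(2m + 1) δ ≤ 3√2 κ`. -/
theorem rate_bound {cg cA cr κ δ : ℝ} (hcg : 0 ≤ cg) (hcA : 0 ≤ cA) (hcr : 0 ≤ cr) (hκ : 0 < κ) (hδ : 0 < δ) {m : ℤ}
    (hm0 : 0 ≤ m) (hmδ : (2 * m + 1) * δ ≤ 3 * Real.sqrt 2 * κ) :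
    cg * (1 / 2 * (cA * (3 * Real.sqrt 2 * κ) ^ (-((1:ℝ) / 3)))) * cr * δ ^ ((1:ℝ) / 3) ≤
      cg * (1 / 2 * (cA * (((2 * m).toNat + 1 : ℕ) : ℝ) ^ (-((1:ℝ) / 3)))) * cr := by
  have hu : 0 < 3 * Real.sqrt 2 * κ := by positivity
  have e : (((2 * m).toNat + 1 : ℕ) : ℝ) = 2 * m + 1 := by
    have : (((2 * m).toNat : ℕ) : ℤ) = 2 * m := Int.toNat_of_nonneg (by omega)
    push_cast; rw [show ((2 * m).toNat : ℝ) = (((2 * m).toNat : ℤ) : ℝ) by push_cast; rfl, this]; push_cast; ring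
  have hm0' : (0 : ℝ) ≤ m := by exact_mod_cast hm0
  have hx : (0 : ℝ) < 2 * m + 1 := by linarith
  have hxy : (2 * m + 1 : ℝ) ≤ 3 * Real.sqrt 2 * κ / δ := by rw [le_div_iff₀ hδ]; exact hmδ
  have hpow : (3 * Real.sqrt 2 * κ) ^ (-((1:ℝ) / 3)) * δ ^ ((1:ℝ) / 3) ≤ (2 * m + 1 : ℝ) ^ (-((1:ℝ) / 3)) := by
    rw [← rpow_neg_third_div hu hδ]
    exact Real.rpow_le_rpow_of_nonpos hx hxy (by norm_num)
  rw [e]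
  calc cg * (1 / 2 * (cA * (3 * Real.sqrt 2 * κ) ^ (-((1:ℝ) / 3)))) * cr * δ ^ ((1:ℝ) / 3)
      = cg * (1 / 2 * (cA * ((3 * Real.sqrt 2 * κ) ^ (-((1:ℝ) / 3)) * δ ^ ((1:ℝ) / 3)))) * cr := by ring
    _ ≤ cg * (1 / 2 * (cA * (2 * m + 1 : ℝ) ^ (-((1:ℝ) / 3)))) * cr := by gcongr

/-- **Registered form of `count_facts` (helper of `freeTouchLower_of_diagArmLower`).** -/
theorem touchLower_count_facts : ∀ (L δ : ℝ), 0 < δ → δ ≤ L / 60 → L / (4 * δ) ≤ (⌊(L / 2 - 6 * δ) / (2 * (Real.sqrt 2 / 2 * δ))⌋₊ : ℝ) ∧ 2 * (Real.sqrt 2 / 2 * δ) * ⌊(L / 2 - 6 * δ) / (2 * (Real.sqrt 2 / 2 * δ))⌋₊ ≤ L / 2 - 6 * δ :=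
  fun _ _ hδ hδL => count_facts hδ hδL

end Summit.CriticalPhenomena.CardyFormulaZ2.Cruxes.ParafermionToSLESixFamilies.PotentialDarbouxPicardDiamond

end
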